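import Summits.CriticalPhenomena.PercolationContinuityZ3.Theorems.PercNearOneGluingNoHeavyLowerTailTwoPartitionPeel
import HarnessLib.Audit

/-!
# `NoHeavyLowerTail` (crux stmt-CriticalPhenomena-4575), master-family hierarchy P3 (gen 30): the RECURSIVE PEELING CHECKER for the three-set
# antipodal functional — a computable Boolean test on an up-set `𝒜 ⊆ 2^[n]` whose success proves `0 ≤ threeSetN 𝒜 ℬ 𝒞` for ALL up-sets `ℬ, 𝒞`

Support file (seat `prim-masterthm-p3`; `--supports stmt-CriticalPhenomena-4575`; memo
`run/shared/lean/prim/prim-masterthm/FROM-prim-masterthm-p3-g30-SPLIT-AND-PEELING.md`, HIERARCHY §37).  Companion of `…TwoPartitionSplit`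
(the one-coordinate split `N(𝒜₀)+N(𝒜₁) ≤ N(𝒜) + #(J∩Jᶜˢ∩ℬ₀∩𝒞₀)`) and `…TwoPartitionPeel` (`threeSetN_nonneg_of_peel`: peeling at any coordinate).

THE CHECKER (this work).  `peelable n 𝒜 : Bool` — `true` on `Fin 0`; on `Fin (n+1)`: `𝒜` is complement-free (`𝒜 ∩ 𝒜ᶜˢ = ∅`), or `𝒜 = univ`, or for some
coordinate `i` the jump set `𝒜_i¹ ∖ 𝒜_i⁰` (layers along `(finSuccEquiv' i).trans optionEquivSumPUnit`) is complement-free and both layers are `peelable`.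
**`threeSetN_nonneg_of_peelable`**: `peelable n 𝒜 = true` together with `𝒜, ℬ, 𝒞` up-sets gives `0 ≤ threeSetN 𝒜 ℬ 𝒞` — i.e. `ThreeSetAntipodal` for
that `𝒜` against every `ℬ, 𝒞`, by structural recursion on `n` through the two faces (`threeSetN_nonneg_of_inter_compls_eq_empty`, `_univ_left`) and
`threeSetN_nonneg_of_peel`.  The checker runs by `decide` on concrete families (examples below: `x₀ ∨ x₁` on `Fin 2` — the `SQKD` equality case —, the
threshold `{2 ≤ #S}` on `Fin 3`, the three-generator family `x₀x₁ ∨ x₀x₂ ∨ x₁x₂x₃` on `Fin 4`, all at default heartbeats).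
CENSUS (evidence, `code-g30/peelclass.py`, same recursion in Python): `peelable = true` for EVERY up-set of `2^[n]`, `n ≤ 4` (3, 6, 20, 168 up-sets), and
for 7 019 of the 7 581 up-sets of `2^[5]` (the 562 others have no coordinate with complement-free jump set).  So every single instance of
`ThreeSetAntipodal` with `𝒜` on at most four points is now a one-line kernel check (`decide`), and with the junta lift (`threeSetN_nonneg_of_junta`) so is every
junta of such an `𝒜`; the blanket statements "all up-sets of `2^[3]`/`2^[4]`" are NOT asserted here (a `decide` over all `2^8`/`2^16` families exceeds the
default heartbeat budget — hygiene), they remain evidence.  HONEST LABEL: a verified decision procedure for a SUFFICIENT condition; `ThreeSetAntipodal` stays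
OPEN (the 562 pinched up-sets of `2^[5]` are its first instances outside the checker's reach). [this work]
-/

namespace Summit.CriticalPhenomena.PercolationContinuityZ3.Theorems.TwoPartition

open Finset
open scoped FinsetFamily

/-- The recursive peeling checker (see the module doc): complement-free, or `univ`, or some coordinate with complement-free jump set and both
layers peelable. [this work] -/
def peelable : (n : ℕ) → Finset (Finset (Fin n)) → Bool
  | 0, _ => true
  | n + 1, 𝒜 => decide (𝒜 ∩ 𝒜ᶜˢ = ∅) || decide (𝒜 = univ) ||
      decide (∃ i : Fin (n + 1),
        (fib (famMap ((finSuccEquiv' i).trans (Equiv.optionEquivSumPUnit.{0, 0} (Fin n))) 𝒜) univ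
            \ fib (famMap ((finSuccEquiv' i).trans (Equiv.optionEquivSumPUnit.{0, 0} (Fin n))) 𝒜) ∅)
          ∩ (fib (famMap ((finSuccEquiv' i).trans (Equiv.optionEquivSumPUnit.{0, 0} (Fin n))) 𝒜) univ
            \ fib (famMap ((finSuccEquiv' i).trans (Equiv.optionEquivSumPUnit.{0, 0} (Fin n))) 𝒜) ∅)ᶜˢ = ∅ ∧
        peelable n (fib (famMap ((finSuccEquiv' i).trans (Equiv.optionEquivSumPUnit.{0, 0} (Fin n))) 𝒜) ∅) = true ∧
        peelable n (fib (famMap ((finSuccEquiv' i).trans (Equiv.optionEquivSumPUnit.{0, 0} (Fin n))) 𝒜) univ) = true)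

/-- On the empty ground set a family is `∅` or `univ`. [folklore] -/
theorem eq_empty_or_eq_univ_fin_zero (𝒜 : Finset (Finset (Fin 0))) : 𝒜 = ∅ ∨ 𝒜 = univ := by
  rcases 𝒜.eq_empty_or_nonempty with h | ⟨S, hS⟩
  · exact Or.inl h
  · refine Or.inr (eq_univ_of_forall fun T => ?_)
    rwa [Subsingleton.elim T S]

/-- **Soundness of the peeling checker** (this work): if `peelable n 𝒜 = true` and `𝒜, ℬ, 𝒞` are up-sets of `2^[n]` then `0 ≤ threeSetN 𝒜 ℬ 𝒞`. [this work] -/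
theorem threeSetN_nonneg_of_peelable : ∀ (n : ℕ) {𝒜 ℬ 𝒞 : Finset (Finset (Fin n))}, peelable n 𝒜 = true →
    IsUpperSet (𝒜 : Set (Finset (Fin n))) → IsUpperSet (ℬ : Set (Finset (Fin n))) → IsUpperSet (𝒞 : Set (Finset (Fin n))) →
    0 ≤ threeSetN 𝒜 ℬ 𝒞
  | 0, 𝒜, ℬ, 𝒞, _, h𝒜, hℬ, h𝒞 => by
    rcases eq_empty_or_eq_univ_fin_zero 𝒜 with h | h
    · rw [h] at h𝒜 ⊢
      exact threeSetN_nonneg_of_inter_compls_eq_empty h𝒜 hℬ h𝒞 (empty_inter _)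
    · rw [h]; exact threeSetN_nonneg_univ_left hℬ h𝒞
  | n + 1, 𝒜, ℬ, 𝒞, h, h𝒜, hℬ, h𝒞 => by
    simp only [peelable, Bool.or_eq_true, decide_eq_true_eq] at h
    rcases h with (hcf | hu) | ⟨i, hJ, h0, h1⟩
    · exact threeSetN_nonneg_of_inter_compls_eq_empty h𝒜 hℬ h𝒞 hcf
    · rw [hu]; exact threeSetN_nonneg_univ_left hℬ h𝒞
    · exact threeSetN_nonneg_of_peel i h𝒜 hℬ h𝒞 hJ
        (threeSetN_nonneg_of_peelable n h0 (isUpperSet_fib (isUpperSet_famMap _ h𝒜) _) (isUpperSet_fib (isUpperSet_famMap _ hℬ) _)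
          (isUpperSet_fib (isUpperSet_famMap _ h𝒞) _))
        (threeSetN_nonneg_of_peelable n h1 (isUpperSet_fib (isUpperSet_famMap _ h𝒜) _) (isUpperSet_fib (isUpperSet_famMap _ hℬ) _)
          (isUpperSet_fib (isUpperSet_famMap _ h𝒞) _))

/-! ### The checker in action (default heartbeats) -/

/-- `x₀ ∨ x₁` on `Fin 2` (the `SQKD` equality configuration) is peelable. [this work] -/
theorem peelable_or_fin_two : peelable 2 (univ.filter fun S : Finset (Fin 2) => S.Nonempty) = true := by decide

/-- The threshold `{2 ≤ #S}` (majority) on `Fin 3` is peelable (indeed complement-free). [this work] -/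
theorem peelable_maj_fin_three : peelable 3 (univ.filter fun S : Finset (Fin 3) => 2 ≤ #S) = true := by decide

/-- The three-generator family `x₀x₁ ∨ x₀x₂ ∨ x₁x₂x₃` on `Fin 4` (not a threshold, not ≤ 2 generators, not complement-free) is peelable. [this work] -/
theorem peelable_threeGen_fin_four : peelable 4 (univ.filter fun S : Finset (Fin 4) =>
    ({0, 1} : Finset (Fin 4)) ⊆ S ∨ ({0, 2} : Finset (Fin 4)) ⊆ S ∨ ({1, 2, 3} : Finset (Fin 4)) ⊆ S) = true := by
  decide

/-- Hence `ThreeSetAntipodal` for `𝒜 = x₀x₁ ∨ x₀x₂ ∨ x₁x₂x₃ ⊆ 2^[4]` against all up-sets `ℬ, 𝒞` — an instance no earlier face covers. [this work] -/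
theorem threeSetN_threeGen_fin_four_nonneg {ℬ 𝒞 : Finset (Finset (Fin 4))} (hℬ : IsUpperSet (ℬ : Set (Finset (Fin 4))))
    (h𝒞 : IsUpperSet (𝒞 : Set (Finset (Fin 4)))) :
    0 ≤ threeSetN (univ.filter fun S : Finset (Fin 4) =>
      ({0, 1} : Finset (Fin 4)) ⊆ S ∨ ({0, 2} : Finset (Fin 4)) ⊆ S ∨ ({1, 2, 3} : Finset (Fin 4)) ⊆ S) ℬ 𝒞 := by
  refine threeSetN_nonneg_of_peelable 4 peelable_threeGen_fin_four ?_ hℬ h𝒞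
  intro S T hST hS
  rw [Finset.mem_coe, mem_filter] at hS ⊢
  refine ⟨mem_univ _, ?_⟩
  rcases hS.2 with h | h | h
  · exact Or.inl (h.trans hST)
  · exact Or.inr (Or.inl (h.trans hST))
  · exact Or.inr (Or.inr (h.trans hST))

end Summit.CriticalPhenomena.PercolationContinuityZ3.Theorems.TwoPartition
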